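import Summits.BirchSwinnertonDyer.BirchSwinnertonDyer.Theorems.ThetaPartnerAtTwoSignedMainConjectureCMTwoRankZeroFlatTwistImaginary
import HarnessLib

/-!
# Route `ThetaPartnerAtTwo`, crux K2r0P `SignedMainConjectureCMTwoRankZeroOfPub` (stmt-BirchSwinnertonDyer-24945),
# line `rankzero` v14, stub (μ♭)_A: imaginary prime quadratic twists, part 2a — the MINUS-SIDE old-class descent
# (one pair of newforms)

Cell `bsd-wall`, width seat `bsd-wall-tp2-p2-w3` (g2). THEOREMS ONLY (no `def`, no named fact, no `sorry`); helper `--supports`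
the crux; sequel of `…FlatTwistImaginary`. BSD is not proved by any of this.

* `distribution_two_mul_ratMinusSymbol` — the `T₂`-relation of `M⁻(x) = 2[x]⁻_g` (no constant term since `[0]⁻ = 0`);
* **`exists_odd_of_plusMinus_congruence`** — for newforms `f` (odd level) and `g` (odd level, `a₂(g)` even) and a non-empty
  odd `S` with `2([b/4^k]⁺_f − [0]⁺_f) ≡ ∑_{t∈S} 2[tb/4^k]⁻_g (mod 2ℤ)` (`k ≥ 1`, `b` odd): an ODD `2[b/4^k]⁻_g` forces an odd
  `2([b'/4^{k'}]⁺_f − [0]⁺_f)` — the transport lemma `OldClassTransport.eq_zero_of_sum_dilations_eq_zero` applied to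
  `F_k(b) = 2[b/4^k]⁻_g mod 2` with `ε = 0`;
* `exists_oddMinus_of_plusMinus_congruence` — the converse (direct: an odd sum of integers has an odd summand).

References: B. Mazur, J. Tate, J. Teitelbaum, Invent. Math. 84 (1986) §I.4 (4.2), §I.8 [MazurTateTeitelbaum1986Invent];
M. Emerton, R. Pollack, T. Weston, Invent. Math. 163 (2006) §4.4 [EmertonPollackWeston2006].
-/

set_option autoImplicit false
-- the Theorems namespace of this sub repeats the summit name by design (D-0017 nested layout)
set_option linter.dupNamespace false

noncomputable section

open scoped Classical MatrixGroups ModularForm NumberField NumberTheorySymbols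

open NumberField IsDedekindDomain Rat.HeightOneSpectrum CongruenceSubgroup
  Literature.NumberTheory.EllipticCurves Literature.NumberTheory.GaloisRepresentations
  WeierstrassCurve Literature.NumberTheory.EllipticCurves.ModularForms Literature.NumberTheory.EllipticCurves.Rank1Residual
  Literature.NumberTheory.EllipticCurves.Rank1Residual.Typed
  Summit.BirchSwinnertonDyer.Rank1Residual Summit.BirchSwinnertonDyer.Rank1Residual.Supersingular

namespace Summit.BirchSwinnertonDyer.BirchSwinnertonDyer.Theorems.FlatTwist.Imaginary

/-! ## The minus-side old-class descent (one pair of newforms) -/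

section Transport

variable {N : ℕ} [NeZero N] (f : CuspForm (Gamma0 N) 2) {N₀ : ℕ} [NeZero N₀] (g : CuspForm (Gamma0 N₀) 2)

/-- **The `T₂`-relation of `M⁻(x) = 2[x]⁻_g`**: `M⁻(x/2) + M⁻((x+1)/2) + M⁻(2x) = a₂(g)·M⁻(x)` (odd level, rational
coefficients). [cite: MazurTateTeitelbaum1986Invent, §I.4 (4.2) and §I.8] -/
theorem distribution_two_mul_ratMinusSymbol (hg : IsNewform0 g) (hQg : coeffField g = ⊥) (h2N₀ : ¬ 2 ∣ N₀) {a : ℤ}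
    (ha : cuspCoeff g 2 = a) (x : ℚ) :
    2 * ratMinusSymbol g (x / 2) + 2 * ratMinusSymbol g ((x + 1) / 2) + 2 * ratMinusSymbol g (2 * x) =
      (a : ℚ) * (2 * ratMinusSymbol g x) := by
  have h := intCast_mul_ratMinusSymbol 2 hg Nat.prime_two h2N₀ ha (ratCast_ratMinusSymbol g hg hQg) x
  rw [Fin.sum_univ_two] at h
  simp only [Fin.val_zero, Fin.val_one, Nat.cast_zero, Nat.cast_one, add_zero, Nat.cast_ofNat] at h
  linear_combination (-2 : ℚ) * h

/-- **MINUS-SIDE OLD-CLASS DESCENT (one pair of newforms).** `f` (odd level `N`) and `g` (odd level `N₀`, `a₂(g) = a` EVEN)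
normalised newforms with rational coefficients, `S ≠ ∅` a finite set of odd naturals with the plus/minus congruence
`2([b/4^k]⁺_f − [0]⁺_f) − ∑_{t∈S} 2[tb/4^k]⁻_g ∈ 2ℤ` (`k ≥ 1`, `b` odd). If some `2[b/4^k]⁻_g` is ODD (`k ≥ 1`, `b` odd), then some
`[b'/4^{k'}]⁺_f = [0]⁺_f + m'/2` with `m'` odd. Mechanism: `OldClassTransport.eq_zero_of_sum_dilations_eq_zero` for
`F_k(b) = 2[b/4^k]⁻_g mod 2` (period `4^k`; even mod `2` since `[−x]⁻ = −[x]⁻`; `T₂`-relations with `ε = 0` because `[0]⁻ = 0`).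
[cite: EmertonPollackWeston2006, Lemma 4.4.4 and Prop. 4.4.5] [cite: MazurTateTeitelbaum1986Invent, §I.4 (4.2), §I.8] -/
theorem exists_odd_of_plusMinus_congruence (hQ : coeffField f = ⊥) (h2N : ¬ 2 ∣ N)
    (hg : IsNewform0 g) (hQg : coeffField g = ⊥) (h2N₀ : ¬ 2 ∣ N₀) {a : ℤ} (ha : cuspCoeff g 2 = a) (haev : Even a)
    (S : Finset ℕ) (hS : S.Nonempty) (hodd : ∀ t ∈ S, Odd t)
    (hcong : ∀ k : ℕ, 1 ≤ k → ∀ b : ℤ, Odd b → ∃ z : ℤ,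
      2 * (ratPlusSymbol f ((b : ℚ) / 4 ^ k) - ratPlusSymbol f 0) -
        ∑ t ∈ S, 2 * ratMinusSymbol g ((((t : ℤ) * b : ℤ) : ℚ) / 4 ^ k) = 2 * z)
    (hres : ∃ k : ℕ, 1 ≤ k ∧ ∃ b : ℤ, Odd b ∧ ∃ m : ℤ, Odd m ∧ 2 * ratMinusSymbol g ((b : ℚ) / 4 ^ k) = m) :
    ∃ k : ℕ, 1 ≤ k ∧ ∃ b : ℤ, Odd b ∧ ∃ m : ℤ, Odd m ∧
      ratPlusSymbol f ((b : ℚ) / 4 ^ k) = ratPlusSymbol f 0 + (m : ℚ) / 2 := by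
  have hrealf : ∀ n, (cuspCoeff f n).im = 0 := cuspCoeff_im_eq_zero_of_coeffField_eq_bot hQ
  have hrealg : ∀ n, (cuspCoeff g n).im = 0 := cuspCoeff_im_eq_zero_of_coeffField_eq_bot hQg
  set Mg : ℚ → ℚ := fun x ↦ 2 * ratMinusSymbol g x with hMg
  have hMg_int : ∀ (c : ℤ) (j : ℕ), ∃ m : ℤ, Mg ((c : ℚ) / 2 ^ j) = m := fun c j ↦
    exists_two_mul_ratMinusSymbol_eq_intCast g hrealg (SignedMuAtTwo.coprime_den_div_two_pow h2N₀ c j)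
  set F : ℕ → ℤ → ZMod 2 := fun k b ↦ (((Mg ((b : ℚ) / 4 ^ k)).num : ℤ) : ZMod 2) with hF
  have hnum : ∀ (x : ℚ) (m : ℤ), Mg x = m → ((Mg x).num : ZMod 2) = (m : ZMod 2) := by
    intro x m h; rw [h, Rat.num_intCast]
  have h4pow : ∀ k : ℕ, ((4 : ℚ) ^ k) = 2 ^ (2 * k) := fun k ↦ by rw [pow_mul]; norm_num
  have hFval : ∀ (k : ℕ) (b m : ℤ), Mg ((b : ℚ) / 4 ^ k) = m → F k b = (m : ZMod 2) := by
    intro k b m h; exact hnum _ _ h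
  have hMg_int4 : ∀ (k : ℕ) (b : ℤ), ∃ m : ℤ, Mg ((b : ℚ) / 4 ^ k) = m := by
    intro k b; rw [h4pow]; exact hMg_int b (2 * k)
  have h2z : (2 : ZMod 2) = 0 := by decide
  -- a `ZMod 2` identity from a `ℚ`-identity between integers (`a` even kills the right-hand side)
  have hcast : ∀ (q₁ q₂ q₃ : ℚ) (m₁ m₂ m₃ m₄ : ℤ), q₁ = m₁ → q₂ = m₂ → q₃ = m₃ →
      q₁ + q₂ + q₃ = (a : ℚ) * m₄ → (m₁ : ZMod 2) + (m₂ : ZMod 2) + (m₃ : ZMod 2) = 0 := by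
    intro q₁ q₂ q₃ m₁ m₂ m₃ m₄ h1 h2 h3 h
    rw [h1, h2, h3] at h
    have hZ : m₁ + m₂ + m₃ = a * m₄ := by exact_mod_cast h
    obtain ⟨r, hr⟩ := haev
    have : (m₁ : ZMod 2) + m₂ + m₃ = ((a * m₄ : ℤ) : ZMod 2) := by rw [← hZ]; push_cast; ring
    rw [this, hr]; push_cast
    linear_combination (r : ZMod 2) * m₄ * h2z
  -- (1) periodicity
  have hper : ∀ k, Function.Periodic (F k) ((4 : ℤ) ^ k) := by
    intro k b
    show (((2 * ratMinusSymbol g (((b + 4 ^ k : ℤ) : ℚ) / 4 ^ k)).num : ℤ) : ZMod 2) =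
      (((2 * ratMinusSymbol g ((b : ℚ) / 4 ^ k)).num : ℤ) : ZMod 2)
    have : (((b + 4 ^ k : ℤ) : ℚ) / 4 ^ k) = (b : ℚ) / 4 ^ k + ((1 : ℤ) : ℚ) := by
      push_cast; field_simp
    rw [this, ratMinusSymbol_add_intCast]
  -- (2) evenness mod 2 (the minus symbol is odd)
  have heven : ∀ k (b : ℤ), F k (-b) = F k b := by
    intro k b
    obtain ⟨m, hm⟩ := hMg_int4 k b
    have hneg : Mg (((-b : ℤ) : ℚ) / 4 ^ k) = ((-m : ℤ) : ℚ) := by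
      have : (((-b : ℤ) : ℚ) / 4 ^ k) = -((b : ℚ) / 4 ^ k) := by push_cast; ring
      rw [this, hMg]
      simp only [ratMinusSymbol_neg]
      have h := hm
      rw [hMg] at h
      push_cast
      linear_combination -h
    rw [hFval k (-b) (-m) hneg, hFval k b m hm, Int.cast_neg, ZMod.neg_eq_self_mod_two]
  -- (3) the distribution relation at `x = b/2^{2k+1}`
  have hdist : ∀ k, 1 ≤ k → ∀ b : ℤ, Odd b → F k b + F (k + 1) b + F (k + 1) (b + 2 ^ (2 * k + 1)) = 0 := by
    intro k _ b _
    set x : ℚ := (b : ℚ) / 2 ^ (2 * k + 1) with hx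
    obtain ⟨m₁, hm₁⟩ := hMg_int4 (k + 1) b
    obtain ⟨m₂, hm₂⟩ := hMg_int4 (k + 1) (b + 2 ^ (2 * k + 1))
    obtain ⟨m₃, hm₃⟩ := hMg_int4 k b
    obtain ⟨m₄, hm₄⟩ := hMg_int b (2 * k + 1)
    have hd := distribution_two_mul_ratMinusSymbol g hg hQg h2N₀ ha x
    have e1 : x / 2 = (b : ℚ) / 4 ^ (k + 1) := by
      rw [hx, h4pow]; field_simp; ring
    have e2 : (x + 1) / 2 = ((b + 2 ^ (2 * k + 1) : ℤ) : ℚ) / 4 ^ (k + 1) := by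
      rw [hx, h4pow]; push_cast; field_simp; ring
    have e3 : 2 * x = (b : ℚ) / 4 ^ k := by
      rw [hx, h4pow]; field_simp; ring
    rw [e1, e2, e3] at hd
    rw [hFval _ _ _ hm₃, hFval _ _ _ hm₁, hFval _ _ _ hm₂]
    have := hcast _ _ _ m₁ m₂ m₃ m₄ hm₁ hm₂ hm₃ (by rw [← hm₄]; exact hd)
    linear_combination this
  -- (4) the distribution relation at `x = b/2` (`M⁻(b) = 2[0]⁻ = 0`)
  have hdist0 : ∀ b : ℤ, Odd b → F 1 b + F 1 (b + 2) = 0 := by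
    intro b _
    set x : ℚ := (b : ℚ) / 2 with hx
    obtain ⟨m₁, hm₁⟩ := hMg_int4 1 b
    obtain ⟨m₂, hm₂⟩ := hMg_int4 1 (b + 2)
    obtain ⟨m₄, hm₄⟩ := hMg_int b 1
    have hd := distribution_two_mul_ratMinusSymbol g hg hQg h2N₀ ha x
    have e1 : x / 2 = (b : ℚ) / 4 ^ 1 := by rw [hx]; ring
    have e2 : (x + 1) / 2 = ((b + 2 : ℤ) : ℚ) / 4 ^ 1 := by rw [hx]; push_cast; ring
    have e3 : Mg (2 * x) = ((0 : ℤ) : ℚ) := by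
      rw [hx, hMg]
      simp only
      rw [show (2 : ℚ) * ((b : ℚ) / 2) = 0 + ((b : ℤ) : ℚ) by ring, ratMinusSymbol_add_intCast, ratMinusSymbol_zero]
      push_cast; ring
    rw [e1, e2] at hd
    rw [hFval _ _ _ hm₁, hFval _ _ _ hm₂]
    have := hcast _ _ _ m₁ m₂ 0 m₄ hm₁ hm₂ e3 (by rw [pow_one] at hm₄; rw [← hm₄]; exact hd)
    simpa using this
  -- suppose, for contradiction, that every `M_f(b/4^k)` is even
  by_contra H
  push Not at H
  have hkill : ∀ k, 1 ≤ k → ∀ b : ℤ, Odd b → ∑ t ∈ S, F k (t * b) = 0 := by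
    intro k hk b hb
    obtain ⟨z, hz⟩ := hcong k hk b hb
    obtain ⟨mf, hmf⟩ := SignedMuAtTwo.exists_two_mul_ratPlusSymbol_sub_eq_intCast f hrealf
      (x := (b : ℚ) / 4 ^ k) (by rw [h4pow]; exact SignedMuAtTwo.coprime_den_div_two_pow h2N b (2 * k))
    have hmf_even : Even mf := by
      by_contra hmo
      rw [Int.not_even_iff_odd] at hmo
      exact H k hk b hb mf hmo (by linear_combination hmf / 2)
    choose m hm using fun t : ℕ ↦ hMg_int4 k ((t : ℤ) * b)
    have hsum : ∑ t ∈ S, F k (t * b) = ((∑ t ∈ S, m t : ℤ) : ZMod 2) := by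
      push_cast
      exact Finset.sum_congr rfl fun t _ ↦ hFval k _ _ (hm t)
    have hm' : ∀ t : ℕ, 2 * ratMinusSymbol g ((((t : ℤ) * b : ℤ) : ℚ) / 4 ^ k) = m t := by
      intro t; have h := hm t; rw [hMg] at h; exact h
    have hZ : (mf : ℚ) - ∑ t ∈ S, (m t : ℚ) = 2 * z := by
      rw [← hmf, ← hz]
      congr 1
      exact Finset.sum_congr rfl fun t _ ↦ (hm' t).symm
    have hZ' : mf - ∑ t ∈ S, m t = 2 * z := by exact_mod_cast hZ
    obtain ⟨r, hr⟩ := hmf_even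
    have : ∑ t ∈ S, m t = r + r - 2 * z := by linarith
    rw [hsum, this]; push_cast
    linear_combination ((r : ZMod 2) - z) * h2z
  have hzero := SignedMuAtTwo.OldClassTransport.eq_zero_of_sum_dilations_eq_zero F 0 hper heven hdist hdist0 S hS hodd
    hkill
  obtain ⟨k, hk, b, hb, m, hmo, hmeq⟩ := hres
  have h1 := hzero k hk b hb
  rw [hFval k b m hmeq] at h1
  obtain ⟨r, hr⟩ := hmo
  rw [hr] at h1; push_cast at h1
  rw [h2z, zero_mul, zero_add] at h1
  exact one_ne_zero h1

omit [NeZero N] in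
/-- **The converse descent** (direct): under the same plus/minus congruence, an odd `2([b/4^k]⁺_f − [0]⁺_f)` forces an odd
`2[tb/4^k]⁻_g` for some `t ∈ S` (`tb` odd) — a sum of even integers is even. [cite: MazurTateTeitelbaum1986Invent, §I.8] -/
theorem exists_oddMinus_of_plusMinus_congruence (hQg : coeffField g = ⊥) (h2N₀ : ¬ 2 ∣ N₀)
    (S : Finset ℕ) (hodd : ∀ t ∈ S, Odd t)
    (hcong : ∀ k : ℕ, 1 ≤ k → ∀ b : ℤ, Odd b → ∃ z : ℤ,
      2 * (ratPlusSymbol f ((b : ℚ) / 4 ^ k) - ratPlusSymbol f 0) -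
        ∑ t ∈ S, 2 * ratMinusSymbol g ((((t : ℤ) * b : ℤ) : ℚ) / 4 ^ k) = 2 * z)
    (hres : ∃ k : ℕ, 1 ≤ k ∧ ∃ b : ℤ, Odd b ∧ ∃ m : ℤ, Odd m ∧
      ratPlusSymbol f ((b : ℚ) / 4 ^ k) = ratPlusSymbol f 0 + (m : ℚ) / 2) :
    ∃ k : ℕ, 1 ≤ k ∧ ∃ b : ℤ, Odd b ∧ ∃ m : ℤ, Odd m ∧ 2 * ratMinusSymbol g ((b : ℚ) / 4 ^ k) = m := by
  obtain ⟨k, hk, b, hb, m, hmo, hmeq⟩ := hres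
  obtain ⟨z, hz⟩ := hcong k hk b hb
  have hrealg : ∀ n, (cuspCoeff g n).im = 0 := cuspCoeff_im_eq_zero_of_coeffField_eq_bot hQg
  have h4pow : ((4 : ℚ) ^ k) = 2 ^ (2 * k) := by rw [pow_mul]; norm_num
  have hint : ∀ t : ℕ, ∃ n : ℤ, 2 * ratMinusSymbol g ((((t : ℤ) * b : ℤ) : ℚ) / 4 ^ k) = n := fun t ↦
    exists_two_mul_ratMinusSymbol_eq_intCast g hrealg
      (by rw [h4pow]; exact SignedMuAtTwo.coprime_den_div_two_pow h2N₀ _ (2 * k))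
  choose n hn using hint
  have hsumQ : ((∑ t ∈ S, n t : ℤ) : ℚ) = m - 2 * z := by
    push_cast
    rw [← Finset.sum_congr rfl fun t _ ↦ hn t, ← hz, hmeq]
    ring
  have hsum : ∑ t ∈ S, n t = m - 2 * z := by exact_mod_cast hsumQ
  have hsodd : Odd (∑ t ∈ S, n t) := by
    rw [hsum]
    exact hmo.sub_even (even_two_mul z)
  obtain ⟨t, ht, hto⟩ : ∃ t ∈ S, Odd (n t) := by
    by_contra hno
    push Not at hno
    have hev : Even (∑ t ∈ S, n t) := Finset.even_sum _ fun t ht ↦ Int.not_odd_iff_even.mp (hno t ht)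
    exact Int.not_odd_iff_even.mpr hev hsodd
  exact ⟨k, hk, (t : ℤ) * b, ((hodd t ht).natCast (R := ℤ)).mul hb, n t, hto, hn t⟩

end Transport

end Summit.BirchSwinnertonDyer.BirchSwinnertonDyer.Theorems.FlatTwist.Imaginary

end
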